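import Literature.MathematicalPhysics.QuantumFieldTheory.Balaban1983to89.B9Eq365QGGQLowerVariational
import Literature.MathematicalPhysics.QuantumFieldTheory.Balaban1983to89.B9Eq384RemainderLetters

/-!
# `Balaban1983to89.B9Eq365QGGQLowerVariationalWindow` — T. Bałaban, *Propagators for lattice gauge theories in a background field*, Commun.
# Math. Phys. **99** (1985) 389–434 [Balaban1985BackgroundPropagators] Thm 3.11 p. 416 with (3.25) p. 394 and (3.65)–(3.67) p. 403: **THE THIRD OPERATOR
# `Q′G′(U)²Q′(U)*` IS BOUNDED BELOW AT EVERY SMALL BACKGROUND OF THE WINDOW BY AN EXPLICIT, VOLUME-FREE CONSTANT, BY FORM BOUNDS ONLY** — the SAME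
# tent test vector as at the flat background (`B9Eq365QGGQLowerVariational`), the transporter letter `εR = 2M_φM_φ′ε` entering only through `|η⁻¹|·εR`
# (η-free in print's scaled window `ε = αη`) and through the averaging letter `ρ′ = (1+εR)^{d(L−1)} − 1`; NO operator norm of `Δ′_{a′}(U)`, NO `‖G′(U) − G′(1)‖`;
# sub-step S3c of route R2′ STEP B7′ of the pub-balaban NE9 chain, WINDOWED half

statement-level skeleton of published theorems with citation tags; proofs where landed; nothing here is a claim about the Yang–Mills mass gap

CITATION HEADER (lean-in-tree rule).  Audit cell `pub-balaban`, sub-cell `t4`, BINDER row NE9; filed by NE9 formalisation-swarm LEAF PROVER 01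
(`b2b-balaban-t4-ne9-formalise-leaf-01`, gen 78) as the second half of sub-step **S3c** of route R2′ STEP B7′ (`t4/ROUTES-NE9.md` v13.19.1 l.408:
«windowed: `⟨A, Δ′_a(U)A⟩ ≤ ⟨A, Δ′_a(1)A⟩ + θ(α)‖A‖₊₁²` by S1-type form bounds … NOT from `‖Δ′_a(U)‖_op`»; first refusal transferred by ne9-leaf-06 g63,
journal l.45066).  Source READ in the held text layer (`paper:balaban1985-cmp99-background-propagators`): p. 394 (3.24)–(3.25), p. 403 («the operators R(U),
P(U) = I − R(U) … satisfy the same bounds»), p. 416 Thm 3.11; [Balaban1984PropagatorsII] p. 236 (2.74)–(2.77) (the lower bound of `Q′G′Q′*` by «a positive,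
absolute constant»).

WHAT IS PROVED (sorry-free; 0 `def`; axioms standard; [folklore] Hilbert-space algebra + the kit's lattice bookkeeping; nothing of [B9]∕[B6] asserted).
* `re_inner_laplacePrimeA` — `re⟪u, Δ′_{a′}(U)u⟫ = ‖η⁻¹D_U u‖² + a′‖Q̃′(U)u‖²` at any background with mutually adjoint transporters (`hRS`).
* `norm_sq_lift_le` (`|b| ≤ B_s ⇒ ‖b·(ψ∘blk)‖² ≤ B_s²(c₀L^d∕c₁)‖ψ‖²`), `abs_tent_le` (the tent is `≤ (L²∕4)^d`).
* **`qggq_coercive_window`** — for `3 ≤ L`, `0 < a′`, the fibre reading `φ` with `‖φw‖ ≤ M_φ‖w‖`, `‖φ⁻¹X‖ ≤ M_φ′‖X‖`, a background `U` with `U(b) ∈ U1`,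
  `‖U(b) − 1‖ ≤ ε`, `hRS`, the displayed positivity `hpos′` of `Δ′_{a′}(U)`, and the WINDOW `ρ′·(L²∕4)^d ≤ β∕2` (`β = ((L−1)(L−2)∕6)^d`): every coarse `ψ` has
  `κ_U·‖ψ‖² ≤ re⟪ψ, (Q̃′(U) ∘ G′(U) ∘ G′(U) ∘ Q̃′(U)†)ψ⟫` — the operator of ne9-leaf-06's `B9Eq325ProjFormula.QGGQ_pos` VERBATIM — with
  `κ_U = ((β∕2)²∕M_U)²·(c₀L^d∕c₁)∕(1+ρ′)²`, `M_U = 2E + 2|η⁻¹|²εR²·d·((L²∕4)^d)²(c₀L^d∕c₁) + a′(β + ρ′(L²∕4)^d)²`, `E = |η⁻¹|²(L(L²∕4)^{d−1})²·d·(c₀L^d∕c₁)`.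
  MECHANISM: `B9Eq365QGGQLowerVariational`'s first-order variational principle + Cauchy–Schwarz at `T = Δ′_{a′}(U)`; the Dirichlet part through
  `B9Eq373DerivativeRemainderL2.norm_covDerivL2K_sub_le` (`‖D_U u − D_1 u‖ ≤ |η⁻¹|εR√d‖u‖`), the averaging part through
  `B9Eq319QprimeLipschitz.sum_norm_sq_QprimeW_sub_flat_le` (`‖Q̃′(U)u − Q̃′(1)u‖ ≤ ρ′√(c₁∕(c₀L^d))‖u‖`), the transporter letter from
  `B9Eq384RemainderLetters.norm_adTransportW_sub_le`.
HONEST SCOPE.  Crude constants; the window is stated on the letter `ρ′` (on the diagonal `ηL = 1` with `ε = αη`: `ρ′ ≤ e^{2dM_φM_φ′α} − 1`, a number in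
`α` — the chain's η-freeness claim, stated, not adjudicated here); `κ_U` depends on `(d, L, η, c₀L^d∕c₁, a′, M_φ, M_φ′, ε)` only — NOT on `m`, NOT on any
operator norm; NOT NE9, NOT the route (cell pub-balaban: NE9 NOT PRINTED ∕ NOT PROVED; «NE9 ⇐ the named binders»; row WALLED ON A MODEL (O-NE9-1;
#5 UNRULED); spine PROVED 0∕9; rung (B)+1 on a finite T⁴ — NOT infinite volume, NOT mass gap, NOT Clay; HONEST DEPENDENCY: continuum YM on T⁴ ⇐ BetaPertH ∧
nine spine estimates (0/9 proved); BetaPertH ⇐ (D1) ∧ (D4) ∧ CAP+tail; G-an2-4 gates asym, D1 and NE2/3/4).  NEW file importing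
`B9Eq365QGGQLowerVariational` (this generation) and `B9Eq384RemainderLetters`; nothing modified.  Net new unproved facts: 0.
-/

noncomputable section

open scoped InnerProductSpace ComplexConjugate BigOperators

namespace Literature.MathematicalPhysics.QuantumFieldTheory.Balaban1983to89.B9Eq365QGGQLowerVariationalWindow

open B4Sect5Torus (TSite)
open B9SectCLatticeCarrier (Bond)
open B9Eq311L2Pairing (WL2)
open B9Eq319QprimeTorus (fineP offset offset_lt blockCoord mem_blockOf_iff)
open B11Eq103H1Complex (SiteL2K greenK apply_greenK covDerivL2K covDivL2K covLaplaceSiteK inner_covDivL2K_covDerivL2K)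
open B9Eq310HessianOperator (adTransportW)
open B5Eq172HodgePositivity (adTransportW_one hRS_one)
open B9Eq326OperatorAssembly (QprimeW)
open B9Eq3119DeltaPiCarrier (laplacePrimeA GpOfU)
open B9Eq325ProjFormula (laplacePrimeA_isSymmetric)
open B9Eq384RemainderLetters (norm_adTransportW_sub_le adTransportW_one_apply)
open B9Eq373DerivativeRemainderL2 (norm_covDerivL2K_sub_le)
open B5Eq172FlatCoercivity (card_blockOf)
open B9Eq319QprimeLipschitz (sum_blockOf_sum sum_norm_sq_QprimeW_sub_flat_le)
open B9Eq319BlockTentLift (sum_profile_eq profile_nonneg profile_le QprimeWL2_one_lift norm_sq_covDerivL2K_lift_le norm_sq_QprimeWL2_one_le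
  sum_blockOf_tent norm_tent_step_le)
open B9Eq365QGGQLowerVariational (sq_div_mul_le_re_inner_green sq_mul_norm_sq_le_re_inner_qggq)

section Window

variable {d : ℕ} (L : ℕ) [NeZero L] (m : Fin d → ℕ) [∀ i, NeZero (fineP L m i)]
  {𝔸 : Type*} [NormedRing 𝔸] [NormedAlgebra ℂ 𝔸] [NormOneClass 𝔸] {W : Type*} [NormedAddCommGroup W] [InnerProductSpace ℂ W]
  [FiniteDimensional ℂ W] (φ : W ≃ₗ[ℂ] 𝔸) (c₀ : ℝ) [Fact (0 < c₀)] (η : ℝ) (c₁ : ℝ) [Fact (0 < c₁)]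

omit [∀ i, NeZero (fineP L m i)] [NormOneClass 𝔸] in
/-- **THE FORM OF `Δ′_{a′}(U)` AT ANY BACKGROUND WITH MUTUALLY ADJOINT TRANSPORTERS**: `re⟪u, Δ′_{a′}(U)u⟫ = ‖η⁻¹D_U u‖² + a′‖Q̃′(U)u‖²`
(`D*_U = D_U†` — `inner_covDivL2K_covDerivL2K` at the displayed `hRS`). [folklore] [cite: Balaban1985BackgroundPropagators, (3.24) p.394, (3.10) p.392] -/
theorem re_inner_laplacePrimeA (a' : ℝ) (U : Bond d (fineP L m) → 𝔸ˣ)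
    (hRS : ∀ (b : Bond d (fineP L m)) (v u : W), ⟪adTransportW φ U b v, u⟫_ℂ = ⟪v, adTransportW φ (fun b => (U b)⁻¹) b u⟫_ℂ)
    (u : SiteL2K ℂ d (fineP L m) c₀ W) :
    RCLike.re ⟪u, laplacePrimeA L m φ η U a' (c₀ := c₀) (c₁ := c₁) u⟫_ℂ =
      ‖covDerivL2K ℂ c₀ ((η : ℂ))⁻¹ (adTransportW φ U) u‖ ^ 2 +
        a' * ‖((WL2.linearEquiv ℂ ℂ (fun _ : TSite d m => c₁)).symm.toLinearMap ∘ₗ QprimeW L m φ U (c₀ := c₀)) u‖ ^ 2 := by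
  have hc : conj (((η : ℂ))⁻¹) = ((η : ℂ))⁻¹ := by rw [map_inv₀, Complex.conj_ofReal]
  have T1 : RCLike.re ⟪u, covLaplaceSiteK ((η : ℂ))⁻¹ (adTransportW φ U) (adTransportW φ fun b => (U b)⁻¹) u⟫_ℂ =
      ‖covDerivL2K ℂ c₀ ((η : ℂ))⁻¹ (adTransportW φ U) u‖ ^ 2 := by
    rw [covLaplaceSiteK, LinearMap.comp_apply, inner_covDivL2K_covDerivL2K _ hc _ _ hRS, ← RCLike.ofReal_pow, RCLike.ofReal_re]
  have T2 : ∀ (Q : SiteL2K ℂ d (fineP L m) c₀ W →ₗ[ℂ] SiteL2K ℂ d m c₁ W),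
      RCLike.re ⟪u, ((a' : ℂ) • (LinearMap.adjoint Q ∘ₗ Q)) u⟫_ℂ = a' * ‖Q u‖ ^ 2 := by
    intro Q
    rw [LinearMap.smul_apply, inner_smul_right, LinearMap.comp_apply, LinearMap.adjoint_inner_right, ← inner_self_eq_norm_sq (𝕜 := ℂ)]
    simp only [RCLike.re_to_complex, Complex.re_ofReal_mul]
  rw [laplacePrimeA, LinearMap.add_apply, inner_add_right, map_add, T1, T2]

omit [∀ i, NeZero (fineP L m i)] [FiniteDimensional ℂ W] [NormOneClass 𝔸] in
/-- **THE `L²` SIZE OF A BLOCK-MODULATED LIFT**: `|b| ≤ B_s` gives `‖u‖² ≤ B_s²·(c₀L^d∕c₁)·‖ψ‖²`. [folklore]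
[cite: Balaban1985BackgroundPropagators, (3.11) p.392; Balaban1985Averaging, (2) p.17] -/
theorem norm_sq_lift_le (b : TSite d (fineP L m) → ℝ) {Bs : ℝ} (hb : ∀ x, |b x| ≤ Bs) (ψ : SiteL2K ℂ d m c₁ W) :
    ‖(WL2.equiv ℂ (fun _ : TSite d (fineP L m) => c₀) W).symm
        (fun x => ((b x : ℝ) : ℂ) • WL2.equiv ℂ (fun _ : TSite d m => c₁) W ψ (blockCoord L m x))‖ ^ 2 ≤
      Bs ^ 2 * (c₀ * (L : ℝ) ^ d / c₁) * ‖ψ‖ ^ 2 := by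
  have hc₀ : 0 < c₀ := Fact.out
  have hc₁ : 0 < c₁ := Fact.out
  set ψt := WL2.equiv ℂ (fun _ : TSite d m => c₁) W ψ with hψt
  rw [WL2.norm_sq]
  have hpt : ∀ x : TSite d (fineP L m), c₀ * ‖WL2.equiv ℂ (fun _ : TSite d (fineP L m) => c₀) W
      ((WL2.equiv ℂ (fun _ : TSite d (fineP L m) => c₀) W).symm (fun x => ((b x : ℝ) : ℂ) • ψt (blockCoord L m x))) x‖ ^ 2 ≤
      c₀ * (Bs ^ 2 * ‖ψt (blockCoord L m x)‖ ^ 2) := fun x => by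
    refine mul_le_mul_of_nonneg_left ?_ hc₀.le
    rw [Equiv.apply_symm_apply, norm_smul, Complex.norm_real, Real.norm_eq_abs, mul_pow]
    exact mul_le_mul_of_nonneg_right (pow_le_pow_left₀ (abs_nonneg _) (hb x) 2) (sq_nonneg _)
  refine (Finset.sum_le_sum fun x _ => hpt x).trans (le_of_eq ?_)
  have hblk : ∑ x : TSite d (fineP L m), ‖ψt (blockCoord L m x)‖ ^ 2 = (L : ℝ) ^ d * ∑ y, ‖ψt y‖ ^ 2 := by
    rw [← sum_blockOf_sum L m (fun x => ‖ψt (blockCoord L m x)‖ ^ 2), Finset.mul_sum]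
    refine Finset.sum_congr rfl fun y _ => ?_
    rw [Finset.sum_congr rfl fun x hx => by rw [(mem_blockOf_iff L m y x).1 hx], Finset.sum_const, card_blockOf, nsmul_eq_mul, Nat.cast_pow]
  have hψ : ‖ψ‖ ^ 2 = c₁ * ∑ y, ‖ψt y‖ ^ 2 := by rw [WL2.norm_sq, Finset.mul_sum]
  rw [← Finset.mul_sum, ← Finset.mul_sum, hblk, hψ]
  field_simp

omit [∀ i, NeZero (fineP L m i)] in
/-- **THE TENT IS BOUNDED BY `(L²∕4)^d`** (each factor `k(L−1−k) ∈ [0, L²∕4]`). [folklore] [cite: Balaban1984PropagatorsII, (2.74)–(2.77) p.236] -/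
theorem abs_tent_le (x : TSite d (fineP L m)) :
    |∏ ν, ((offset L m x ν : ℕ) : ℝ) * ((L : ℝ) - 1 - (offset L m x ν : ℕ))| ≤ ((L : ℝ) ^ 2 / 4) ^ d := by
  rw [abs_of_nonneg (Finset.prod_nonneg fun ν _ => profile_nonneg (offset_lt L m x ν))]
  have h := Finset.prod_le_prod (s := Finset.univ) (fun ν _ => profile_nonneg (offset_lt L m x ν)) (fun ν _ => profile_le L (offset L m x ν))
  rwa [Finset.prod_const, Finset.card_univ, Fintype.card_fin] at h

/-- `(a + b)² ≤ 2a² + 2b²` (private arithmetic helper). [folklore] -/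
private theorem add_sq_le_two_sq (a b : ℝ) : (a + b) ^ 2 ≤ 2 * a ^ 2 + 2 * b ^ 2 := by nlinarith [sq_nonneg (a - b)]

-- heartbeat headroom: the proof elaborates at the default budget in the farm's concat form (≈35 s) but the gate's import-form run
-- reached 200 000 at the theorem head once (18:5xZ); 400 000 is the ops precedent (`B9Thm311SmallFieldCoercivityTower`, p333837).
set_option maxHeartbeats 400000 in
/-- **S3c IN THE WINDOW — AN EXPLICIT LOWER BOUND FOR `Q̃′(U)G′(U)²Q̃′(U)†` AT A SMALL BACKGROUND, BY FORM BOUNDS ONLY**: for `3 ≤ L`, `0 < a′`, a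
background `U` with `U(b) ∈ U1`, `‖U(b) − 1‖ ≤ ε`, mutually adjoint transporters (`hRS`), the displayed positivity `hpos′` of `Δ′_{a′}(U)`, and the WINDOW
`ρ′·(L²∕4)^d ≤ β∕2` on the averaging letter `ρ′ := (1 + 2M_φM_φ′ε)^{d(L−1)} − 1`: every coarse `ψ` has `κ_U·‖ψ‖² ≤ re⟪ψ, Q̃′(U)G′(U)²Q̃′(U)†ψ⟫` with
`κ_U = ((β∕2)²∕M_U)²·(c₀L^d∕c₁)∕(1 + ρ′)²`, `M_U = 2E + 2|η⁻¹|²(2M_φM_φ′ε)²·d·((L²∕4)^d)²(c₀L^d∕c₁) + a′(β + ρ′(L²∕4)^d)²` (`β`, `E` as in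
`B9Eq365QGGQLowerVariational.qggq_coercive_flat`) — the SAME tent test vector at `U`, the transporter letter `εR = 2M_φM_φ′ε` entering only through
`|η⁻¹|·εR` (η-free in print's scaled window `ε = αη`) and `ρ′`; NO operator norm of `Δ′_{a′}(U)`, NO `‖G′(U) − G′(1)‖`.
[cite: Balaban1985BackgroundPropagators, Thm 3.11 p.416, (3.65)–(3.67) p.403, (3.25) p.394; Balaban1984PropagatorsII, (2.74)–(2.77) p.236] -/
theorem qggq_coercive_window (hL3 : 3 ≤ L) {a' : ℝ} (ha' : 0 < a') {Mφ Mφ' : ℝ} (hMφ : 0 ≤ Mφ) (hMφ' : 0 ≤ Mφ')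
    (hφ : ∀ w, ‖φ w‖ ≤ Mφ * ‖w‖) (hφ' : ∀ X, ‖φ.symm X‖ ≤ Mφ' * ‖X‖)
    (U : Bond d (fineP L m) → 𝔸ˣ) (hU : ∀ b, U b ∈ B7Prop1Explicit.U1 𝔸) {ε : ℝ} (hε : 0 ≤ ε) (hUε : ∀ b, ‖(U b : 𝔸) - 1‖ ≤ ε)
    (hRS : ∀ (b : Bond d (fineP L m)) (v u : W), ⟪adTransportW φ U b v, u⟫_ℂ = ⟪v, adTransportW φ (fun b => (U b)⁻¹) b u⟫_ℂ)
    (hpos' : ∀ x : SiteL2K ℂ d (fineP L m) c₀ W, x ≠ 0 → 0 < RCLike.re ⟪x, laplacePrimeA L m φ η U a' (c₁ := c₁) x⟫_ℂ)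
    (hwin : ((1 + 2 * Mφ * Mφ' * ε) ^ (d * (L - 1)) - 1) * ((L : ℝ) ^ 2 / 4) ^ d ≤ (((L : ℝ) - 1) * ((L : ℝ) - 2) / 6) ^ d / 2)
    (ψ : SiteL2K ℂ d m c₁ W) :
    ((((((L : ℝ) - 1) * ((L : ℝ) - 2) / 6) ^ d / 2) ^ 2 /
          (2 * (‖((η : ℂ))⁻¹‖ ^ 2 * ((L : ℝ) * ((L : ℝ) ^ 2 / 4) ^ (d - 1)) ^ 2 * (d : ℝ) * (c₀ * (L : ℝ) ^ d / c₁)) +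
            2 * (‖((η : ℂ))⁻¹‖ ^ 2 * (2 * Mφ * Mφ' * ε) ^ 2 * (d : ℝ) * (((L : ℝ) ^ 2 / 4) ^ d) ^ 2 * (c₀ * (L : ℝ) ^ d / c₁)) +
            a' * ((((L : ℝ) - 1) * ((L : ℝ) - 2) / 6) ^ d + (((1 + 2 * Mφ * Mφ' * ε) ^ (d * (L - 1)) - 1) * ((L : ℝ) ^ 2 / 4) ^ d)) ^ 2)) ^ 2 *
        (c₀ * (L : ℝ) ^ d / c₁) / (1 + (((1 + 2 * Mφ * Mφ' * ε) ^ (d * (L - 1)) - 1))) ^ 2) * ‖ψ‖ ^ 2 ≤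
      RCLike.re ⟪ψ, (((WL2.linearEquiv ℂ ℂ (fun _ : TSite d m => c₁)).symm.toLinearMap ∘ₗ QprimeW L m φ U (c₀ := c₀)) ∘ₗ
        GpOfU L m φ η U a' (c₁ := c₁) hpos' ∘ₗ GpOfU L m φ η U a' (c₁ := c₁) hpos' ∘ₗ
        LinearMap.adjoint ((WL2.linearEquiv ℂ ℂ (fun _ : TSite d m => c₁)).symm.toLinearMap ∘ₗ QprimeW L m φ U (c₀ := c₀))) ψ⟫_ℂ := by
  have hc₀ : 0 < c₀ := Fact.out
  have hc₁ : 0 < c₁ := Fact.out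
  have hL0 : (0 : ℝ) < L := by exact_mod_cast lt_of_lt_of_le (by norm_num) hL3
  have hL1 : (3 : ℝ) ≤ L := by exact_mod_cast hL3
  -- letters
  set Q : SiteL2K ℂ d (fineP L m) c₀ W →ₗ[ℂ] SiteL2K ℂ d m c₁ W :=
    (WL2.linearEquiv ℂ ℂ (fun _ : TSite d m => c₁)).symm.toLinearMap ∘ₗ QprimeW L m φ U (c₀ := c₀) with hQ
  set Q₁ : SiteL2K ℂ d (fineP L m) c₀ W →ₗ[ℂ] SiteL2K ℂ d m c₁ W :=
    (WL2.linearEquiv ℂ ℂ (fun _ : TSite d m => c₁)).symm.toLinearMap ∘ₗ QprimeW L m φ (fun _ : Bond d (fineP L m) => (1 : 𝔸ˣ)) (c₀ := c₀)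
    with hQ₁
  set T := laplacePrimeA L m φ η U a' (c₀ := c₀) (c₁ := c₁) with hT
  have hTs : T.IsSymmetric := laplacePrimeA_isSymmetric L m φ c₀ η U c₁ a' hRS
  set S : ℝ := ∑ k ∈ Finset.range L, (k : ℝ) * ((L : ℝ) - 1 - k) with hS
  set β : ℝ := (((L : ℝ) - 1) * ((L : ℝ) - 2) / 6) ^ d with hβ
  set Bs : ℝ := ((L : ℝ) ^ 2 / 4) ^ d with hBs
  set D : ℝ := (L : ℝ) * ((L : ℝ) ^ 2 / 4) ^ (d - 1) with hD
  set ρw : ℝ := c₀ * (L : ℝ) ^ d / c₁ with hρw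
  set E : ℝ := ‖((η : ℂ))⁻¹‖ ^ 2 * D ^ 2 * (d : ℝ) * ρw with hE
  set εR : ℝ := 2 * Mφ * Mφ' * ε with hεR
  set ρ' : ℝ := (1 + εR) ^ (d * (L - 1)) - 1 with hρ'
  set E' : ℝ := ‖((η : ℂ))⁻¹‖ ^ 2 * εR ^ 2 * (d : ℝ) * Bs ^ 2 * ρw with hE'
  set M : ℝ := 2 * E + 2 * E' + a' * (β + ρ' * Bs) ^ 2 with hM
  have hβS : ((L : ℝ) ^ d)⁻¹ * S ^ d = β := by
    rw [hS, sum_profile_eq, hβ, ← inv_pow, ← mul_pow]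
    congr 1
    field_simp
  have hβ0 : 0 < β := by rw [hβ]; exact pow_pos (by nlinarith) d
  have hBs0 : 0 ≤ Bs := by rw [hBs]; positivity
  have hD0 : 0 ≤ D := by rw [hD]; positivity
  have hρw0 : 0 < ρw := by rw [hρw]; positivity
  have hεR0 : 0 ≤ εR := by rw [hεR]; positivity
  have hρ'0 : 0 ≤ ρ' := by rw [hρ']; exact sub_nonneg.2 (one_le_pow₀ (by linarith))
  have hE0 : 0 ≤ E := by rw [hE]; positivity
  have hE'0 : 0 ≤ E' := by rw [hE']; positivity
  have hM0 : 0 < M := by rw [hM]; positivity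
  have hwin' : ρ' * Bs ≤ β / 2 := hwin
  -- the test vector
  set ψt := WL2.equiv ℂ (fun _ : TSite d m => c₁) W ψ with hψt
  set u : SiteL2K ℂ d (fineP L m) c₀ W := (WL2.equiv ℂ (fun _ : TSite d (fineP L m) => c₀) W).symm
    (fun x => (((∏ ν, ((offset L m x ν : ℕ) : ℝ) * ((L : ℝ) - 1 - (offset L m x ν : ℕ))) : ℝ) : ℂ) • ψt (blockCoord L m x)) with hu
  have hQ₁u : Q₁ u = ((β : ℝ) : ℂ) • ψ := by
    rw [← hβS]; exact QprimeWL2_one_lift L m φ c₀ c₁ _ (fun y => sum_blockOf_tent L m y) ψ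
  have hun : ‖u‖ ^ 2 ≤ Bs ^ 2 * ρw * ‖ψ‖ ^ 2 := by
    have h := norm_sq_lift_le L m c₀ c₁ (fun x => ∏ ν, ((offset L m x ν : ℕ) : ℝ) * ((L : ℝ) - 1 - (offset L m x ν : ℕ)))
      (abs_tent_le L m) ψ
    rw [hρw]; exact h
  have hun' : ‖u‖ ≤ Bs * Real.sqrt ρw * ‖ψ‖ := by
    have h2 : (Bs * Real.sqrt ρw * ‖ψ‖) ^ 2 = Bs ^ 2 * ρw * ‖ψ‖ ^ 2 := by rw [mul_pow, mul_pow, Real.sq_sqrt hρw0.le]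
    exact (pow_le_pow_iff_left₀ (norm_nonneg _) (by positivity) two_ne_zero).1 (h2 ▸ hun)
  -- the transporter letter and the averaging letter
  have hR : ∀ (b : Bond d (fineP L m)) (w : W), ‖adTransportW φ U b w - w‖ ≤ εR * ‖w‖ := fun b w => by
    rw [hεR]; exact norm_adTransportW_sub_le φ hφ hφ' hMφ' U b (hU b) (hUε b) w
  have hδ : ‖Q u - Q₁ u‖ ≤ ρ' * Bs * ‖ψ‖ := by
    -- `‖Q̃′(U)u − Q̃′(1)u‖²_{c₁} = c₁ Σ_y ‖…‖² ≤ ρ′²·(c₁∕(L^d c₀))·‖u‖² ≤ (ρ′ B_s ‖ψ‖)²`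
    have h1 := sum_norm_sq_QprimeW_sub_flat_le L m φ U hεR0 hR u
    have h2 : ‖Q u - Q₁ u‖ ^ 2 = c₁ * ∑ y, ‖QprimeW L m φ U (c₀ := c₀) u y - QprimeW L m φ (fun _ => 1) (c₀ := c₀) u y‖ ^ 2 := by
      rw [WL2.norm_sq, Finset.mul_sum]; rfl
    have h3 : ‖Q u - Q₁ u‖ ^ 2 ≤ (ρ' * Bs * ‖ψ‖) ^ 2 := by
      rw [h2]
      calc c₁ * ∑ y, ‖QprimeW L m φ U (c₀ := c₀) u y - QprimeW L m φ (fun _ => 1) (c₀ := c₀) u y‖ ^ 2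
          ≤ c₁ * (ρ' ^ 2 * (((L : ℝ) ^ d * c₀)⁻¹ * ‖u‖ ^ 2)) := mul_le_mul_of_nonneg_left h1 hc₁.le
        _ ≤ c₁ * (ρ' ^ 2 * (((L : ℝ) ^ d * c₀)⁻¹ * (Bs ^ 2 * ρw * ‖ψ‖ ^ 2))) := by gcongr
        _ = (ρ' * Bs * ‖ψ‖) ^ 2 := by rw [hρw]; field_simp
    exact (pow_le_pow_iff_left₀ (norm_nonneg _) (by positivity) two_ne_zero).1 h3
  have hQu : Q u = ((β : ℝ) : ℂ) • ψ + (Q u - Q₁ u) := by rw [hQ₁u]; abel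
  -- (1) `(β∕2)‖ψ‖² ≤ re⟪u, Q†ψ⟫`
  have hux : β / 2 * ‖ψ‖ ^ 2 ≤ RCLike.re ⟪u, LinearMap.adjoint Q ψ⟫_ℂ := by
    rw [LinearMap.adjoint_inner_right, hQu, inner_add_left, map_add, inner_smul_left, Complex.conj_ofReal]
    have e1 : RCLike.re ((β : ℂ) * ⟪ψ, ψ⟫_ℂ) = β * ‖ψ‖ ^ 2 := by
      rw [← inner_self_eq_norm_sq (𝕜 := ℂ) ψ]; simp only [RCLike.re_to_complex, Complex.re_ofReal_mul]
    rw [e1]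
    have e2 : |RCLike.re ⟪Q u - Q₁ u, ψ⟫_ℂ| ≤ ρ' * Bs * ‖ψ‖ * ‖ψ‖ :=
      (RCLike.abs_re_le_norm _).trans ((norm_inner_le_norm _ _).trans (mul_le_mul_of_nonneg_right hδ (norm_nonneg _)))
    have e3 := neg_le_of_abs_le e2
    have h5 : ρ' * Bs * ‖ψ‖ * ‖ψ‖ ≤ β / 2 * ‖ψ‖ ^ 2 := by
      rw [mul_assoc (ρ' * Bs), ← pow_two]; exact mul_le_mul_of_nonneg_right hwin' (sq_nonneg _)
    linarith [e3, h5]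
  -- (2) `re⟪u, Tu⟫ ≤ M‖ψ‖²`
  have huu : RCLike.re ⟪u, T u⟫_ℂ ≤ M * ‖ψ‖ ^ 2 := by
    rw [hT, re_inner_laplacePrimeA L m φ c₀ η c₁ a' U hRS u]
    -- Dirichlet part: `‖D_U u‖ ≤ ‖D_1 u‖ + |η⁻¹|εR√d‖u‖`
    have hD1 := norm_sq_covDerivL2K_lift_le L m φ c₀ η c₁
      (fun x => ∏ ν, ((offset L m x ν : ℕ) : ℝ) * ((L : ℝ) - 1 - (offset L m x ν : ℕ))) (D := D) ψ (norm_tent_step_le L m ψt)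
    have hD1' : ‖covDerivL2K ℂ c₀ ((η : ℂ))⁻¹ (adTransportW φ (fun _ : Bond d (fineP L m) => (1 : 𝔸ˣ))) u‖ ^ 2 ≤ E * ‖ψ‖ ^ 2 := by
      rw [hE, hρw]; exact hD1
    have hdiff := norm_covDerivL2K_sub_le (𝕜 := ℂ) (c₀ := c₀) (c := ((η : ℂ))⁻¹) (R := adTransportW φ U)
      (R₁ := adTransportW φ (fun _ : Bond d (fineP L m) => (1 : 𝔸ˣ))) hεR0 hR (adTransportW_one_apply L m φ) u
    have hDU : ‖covDerivL2K ℂ c₀ ((η : ℂ))⁻¹ (adTransportW φ U) u‖ ≤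
        ‖covDerivL2K ℂ c₀ ((η : ℂ))⁻¹ (adTransportW φ (fun _ : Bond d (fineP L m) => (1 : 𝔸ˣ))) u‖ + ‖((η : ℂ))⁻¹‖ * εR * Real.sqrt d * ‖u‖ :=
      (norm_le_insert' _ _).trans (add_le_add le_rfl hdiff)
    -- `‖D_1 u‖ ≤ √E‖ψ‖`, `‖u‖ ≤ B_s√ρw‖ψ‖`
    have ha₁ : ‖covDerivL2K ℂ c₀ ((η : ℂ))⁻¹ (adTransportW φ (fun _ : Bond d (fineP L m) => (1 : 𝔸ˣ))) u‖ ≤ Real.sqrt E * ‖ψ‖ := by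
      have h2 : (Real.sqrt E * ‖ψ‖) ^ 2 = E * ‖ψ‖ ^ 2 := by rw [mul_pow, Real.sq_sqrt hE0]
      exact (pow_le_pow_iff_left₀ (norm_nonneg _) (by positivity) two_ne_zero).1 (h2 ▸ hD1')
    have ha₂ : ‖((η : ℂ))⁻¹‖ * εR * Real.sqrt d * ‖u‖ ≤ ‖((η : ℂ))⁻¹‖ * εR * Real.sqrt d * (Bs * Real.sqrt ρw * ‖ψ‖) :=
      mul_le_mul_of_nonneg_left hun' (by positivity)
    have hDU' : ‖covDerivL2K ℂ c₀ ((η : ℂ))⁻¹ (adTransportW φ U) u‖ ≤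
        (Real.sqrt E + ‖((η : ℂ))⁻¹‖ * εR * Real.sqrt d * Bs * Real.sqrt ρw) * ‖ψ‖ := by
      refine hDU.trans ?_
      have := add_le_add ha₁ ha₂
      refine this.trans (le_of_eq ?_)
      ring
    have hsq : ‖covDerivL2K ℂ c₀ ((η : ℂ))⁻¹ (adTransportW φ U) u‖ ^ 2 ≤ (2 * E + 2 * E') * ‖ψ‖ ^ 2 := by
      have h1 : ‖covDerivL2K ℂ c₀ ((η : ℂ))⁻¹ (adTransportW φ U) u‖ ^ 2 ≤
          ((Real.sqrt E + ‖((η : ℂ))⁻¹‖ * εR * Real.sqrt d * Bs * Real.sqrt ρw) * ‖ψ‖) ^ 2 :=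
        pow_le_pow_left₀ (norm_nonneg _) hDU' 2
      refine h1.trans ?_
      have hd0 : (0 : ℝ) ≤ d := Nat.cast_nonneg d
      -- `(a + b)² ≤ 2a² + 2b²`, `(√E)² = E`, `(√d)² = d`, `(√ρw)² = ρw`
      have e1 : ((Real.sqrt E + ‖((η : ℂ))⁻¹‖ * εR * Real.sqrt d * Bs * Real.sqrt ρw) * ‖ψ‖) ^ 2 ≤
          (2 * (Real.sqrt E) ^ 2 + 2 * (‖((η : ℂ))⁻¹‖ * εR * Real.sqrt d * Bs * Real.sqrt ρw) ^ 2) * ‖ψ‖ ^ 2 := by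
        rw [mul_pow]
        refine mul_le_mul_of_nonneg_right ?_ (sq_nonneg _)
        exact add_sq_le_two_sq _ _
      refine e1.trans (le_of_eq ?_)
      rw [Real.sq_sqrt hE0, mul_pow, mul_pow, mul_pow, mul_pow, Real.sq_sqrt hd0, Real.sq_sqrt hρw0.le, hE']
    -- averaging part: `‖Q u‖ ≤ (β + ρ′B_s)‖ψ‖`
    have hQn : ‖Q u‖ ≤ (β + ρ' * Bs) * ‖ψ‖ := by
      rw [hQu]
      refine (norm_add_le _ _).trans ?_
      rw [norm_smul, Complex.norm_real, Real.norm_eq_abs, abs_of_pos hβ0, add_mul]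
      exact add_le_add le_rfl hδ
    have hQsq : a' * ‖Q u‖ ^ 2 ≤ a' * ((β + ρ' * Bs) ^ 2 * ‖ψ‖ ^ 2) := by
      refine mul_le_mul_of_nonneg_left ?_ ha'.le
      rw [← mul_pow]; exact pow_le_pow_left₀ (norm_nonneg _) hQn 2
    rw [← hQ]
    calc _ ≤ (2 * E + 2 * E') * ‖ψ‖ ^ 2 + a' * ((β + ρ' * Bs) ^ 2 * ‖ψ‖ ^ 2) := add_le_add hsq hQsq
      _ = M * ‖ψ‖ ^ 2 := by rw [hM]; ring
  -- (3) the first-order variational principle: `κ₁‖ψ‖² ≤ re⟪Q†ψ, G′(U)Q†ψ⟫`, `κ₁ = (β∕2)²∕M`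
  have hG : ∀ z, GpOfU L m φ η U a' (c₁ := c₁) hpos' z = greenK T hpos' z := fun z => rfl
  have hκ₁ := sq_div_mul_le_re_inner_green hTs hpos' hM0 (by positivity : (0 : ℝ) ≤ β / 2) hux huu
  -- (4) Cauchy–Schwarz with `‖Q̃′(U)‖ ≤ N := (1 + ρ′)√(c₁∕(c₀L^d))`
  have hN0 : 0 < (1 + ρ') * Real.sqrt (c₁ / (c₀ * (L : ℝ) ^ d)) := by positivity
  have hQv : ∀ v, ‖Q v‖ ≤ (1 + ρ') * Real.sqrt (c₁ / (c₀ * (L : ℝ) ^ d)) * ‖v‖ := fun v => by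
    have h1 : ‖Q₁ v‖ ≤ Real.sqrt (c₁ / (c₀ * (L : ℝ) ^ d)) * ‖v‖ := by
      have h := norm_sq_QprimeWL2_one_le L m φ c₀ c₁ v
      rw [← hQ₁] at h
      refine (pow_le_pow_iff_left₀ (norm_nonneg _) (by positivity) two_ne_zero).1 ?_
      rw [mul_pow, Real.sq_sqrt (by positivity)]
      exact h
    have h2 : ‖Q v - Q₁ v‖ ≤ ρ' * Real.sqrt (c₁ / (c₀ * (L : ℝ) ^ d)) * ‖v‖ := by
      have hs := sum_norm_sq_QprimeW_sub_flat_le L m φ U hεR0 hR v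
      have h3 : ‖Q v - Q₁ v‖ ^ 2 = c₁ * ∑ y, ‖QprimeW L m φ U (c₀ := c₀) v y - QprimeW L m φ (fun _ => 1) (c₀ := c₀) v y‖ ^ 2 := by
        rw [WL2.norm_sq, Finset.mul_sum]; rfl
      have h4 : ‖Q v - Q₁ v‖ ^ 2 ≤ (ρ' * Real.sqrt (c₁ / (c₀ * (L : ℝ) ^ d)) * ‖v‖) ^ 2 := by
        rw [h3, mul_pow, mul_pow, Real.sq_sqrt (by positivity)]
        calc c₁ * ∑ y, ‖QprimeW L m φ U (c₀ := c₀) v y - QprimeW L m φ (fun _ => 1) (c₀ := c₀) v y‖ ^ 2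
            ≤ c₁ * (ρ' ^ 2 * (((L : ℝ) ^ d * c₀)⁻¹ * ‖v‖ ^ 2)) := mul_le_mul_of_nonneg_left hs hc₁.le
          _ = ρ' ^ 2 * (c₁ / (c₀ * (L : ℝ) ^ d)) * ‖v‖ ^ 2 := by field_simp
      exact (pow_le_pow_iff_left₀ (norm_nonneg _) (by positivity) two_ne_zero).1 h4
    calc ‖Q v‖ ≤ ‖Q₁ v‖ + ‖Q v - Q₁ v‖ := norm_le_insert' _ _
      _ ≤ Real.sqrt (c₁ / (c₀ * (L : ℝ) ^ d)) * ‖v‖ + ρ' * Real.sqrt (c₁ / (c₀ * (L : ℝ) ^ d)) * ‖v‖ := add_le_add h1 h2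
      _ = (1 + ρ') * Real.sqrt (c₁ / (c₀ * (L : ℝ) ^ d)) * ‖v‖ := by ring
  have hfin := sq_mul_norm_sq_le_re_inner_qggq hTs hpos' Q hN0 (div_nonneg (sq_nonneg _) hM0.le) hQv ψ hκ₁
  -- (5) the constant
  have hconst : ((β / 2) ^ 2 / M / ((1 + ρ') * Real.sqrt (c₁ / (c₀ * (L : ℝ) ^ d)))) ^ 2 =
      ((β / 2) ^ 2 / M) ^ 2 * (c₀ * (L : ℝ) ^ d / c₁) / (1 + ρ') ^ 2 := by
    rw [div_pow, mul_pow, Real.sq_sqrt (by positivity)]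
    field_simp
  rw [hconst, hM, hE, hE', hD, hBs, hρw, hρ', hεR] at hfin
  simpa only [LinearMap.comp_apply, hG] using hfin

end Window


end Literature.MathematicalPhysics.QuantumFieldTheory.Balaban1983to89.B9Eq365QGGQLowerVariationalWindow

end
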